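import Summits.QuantumFields.QCD.Theses.SpectralDefectExtinction
import Literature.MathematicalPhysics.QuantumFieldTheory.QCDPhaseQuenched
import Literature.Barriers.QuantumFields.WilsonDeterminantSign
import Literature.Analysis.OperatorTheory.CayleyUnitary

/-!
# Crux-ideate round 2, ideator 5 — first lemmas for the two idea cards on
# crux stmt-QuantumFields-18064 `ExtinctionBuildsQCD` (SD⁺ → THR)

Card A `fermionic-level-repulsion` : §A (2×2 resonance algebra; abstract self-improvement lemma;
the determinantal window law / two-well non-resonance as typed stub shapes).

Card B `degenerate-anchor-mass-shift` : §B (Neumann cone: a window-clean DEGENERATE bare mass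
`m̄` controls `det D_W(μ)` for all `|μ − m̄| < w`; split-pair positivity; mass-shift factorisation).

Everything here is configuration-wise linear algebra or abstract measure theory; `sorry` marks the
statements that are only SIGNATURES at this stage (crux-ideate files no skeleton).
-/

noncomputable section

namespace Summit.QuantumFields.QCD.Cruxes.ExtinctionBuildsQCD.Ideator5

open scoped BigOperators Topology Classical MeasureTheory Matrix
open Filter MeasureTheory Matrix
open Literature.MathematicalPhysics.QuantumLattice Literature.MathematicalPhysics.QuantumFieldTheory
  Literature.Probability.LatticeModels
open Literature.Barriers.QuantumFields.WilsonDeterminant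
open Summit.QuantumFields.QCD.Theses.SpectralDefectExtinction

/-! ## §B  Card B — the degenerate anchor and the mass-shift cone -/

section ConeAbstract

open scoped Matrix.Norms.L2Operator

variable {n : Type*} [Fintype n] [DecidableEq n]

/-- **B0 (mass-shift factorisation).** For any square matrix `D` and scalars `a b`, if `D + a` is
invertible then `det (D + b) = det (D + a) · det (1 + (b − a)(D + a)⁻¹)`.  (Wilson reading: the
honest weight at bare mass `μ` is the honest weight at the DEGENERATE bare mass `m̄` times a
mass-shift determinant; `wilsonDirac U μ 1 − wilsonDirac U m̄ 1 = (μ − m̄) • 1`.) -/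
theorem det_add_smul_eq_mul_det_one_add (D : Matrix n n ℂ) (a b : ℂ)
    (hA : IsUnit (D + a • (1 : Matrix n n ℂ))) :
    (D + b • (1 : Matrix n n ℂ)).det =
      (D + a • (1 : Matrix n n ℂ)).det *
        (1 + (b - a) • (D + a • (1 : Matrix n n ℂ))⁻¹).det := by
  rw [← det_mul]
  congr 1
  have hinv : (D + a • (1 : Matrix n n ℂ)) * (D + a • (1 : Matrix n n ℂ))⁻¹ = 1 :=
    Matrix.mul_nonsing_inv _ ((Matrix.isUnit_iff_isUnit_det _).mp hA)
  rw [mul_add, mul_one, Matrix.mul_smul, hinv]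
  ext i j
  simp only [Matrix.add_apply, Matrix.smul_apply, Matrix.one_apply, smul_eq_mul, mul_ite, mul_one,
    mul_zero]
  split_ifs <;> ring

/-- **B0′ (Neumann cone, abstract).** If `D + a` is invertible and `‖b − a‖ · ‖(D + a)⁻¹‖ < 1`
(ℓ²-operator norm) then `D + b` is invertible.  [signature; proof = `isUnit_one_add_of_norm_lt`
applied to `(b − a)(D + a)⁻¹` and B0] -/
theorem isUnit_add_smul_of_neumann (D : Matrix n n ℂ) (a b : ℂ)
    (hA : IsUnit (D + a • (1 : Matrix n n ℂ)))
    (h : ‖b - a‖ * ‖(D + a • (1 : Matrix n n ℂ))⁻¹‖ < 1) :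
    IsUnit (D + b • (1 : Matrix n n ℂ)) := by
  haveI : CompleteSpace (Matrix n n ℂ) := FiniteDimensional.complete ℂ _
  have hinv : (D + a • (1 : Matrix n n ℂ)) * (D + a • (1 : Matrix n n ℂ))⁻¹ = 1 :=
    Matrix.mul_nonsing_inv _ ((Matrix.isUnit_iff_isUnit_det _).mp hA)
  have hfac : D + b • (1 : Matrix n n ℂ) =
      (D + a • (1 : Matrix n n ℂ)) * (1 + (b - a) • (D + a • (1 : Matrix n n ℂ))⁻¹) := by
    rw [mul_add, mul_one, Matrix.mul_smul, hinv]
    ext i j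
    simp only [Matrix.add_apply, Matrix.smul_apply, Matrix.one_apply, smul_eq_mul, mul_ite, mul_one,
      mul_zero]
    split_ifs <;> ring
  have hx : ‖(b - a) • (D + a • (1 : Matrix n n ℂ))⁻¹‖ < 1 :=
    (norm_smul_le _ _).trans_lt h
  rw [hfac]
  exact hA.mul (Literature.Analysis.OperatorTheory.isUnit_one_add_of_norm_lt hx)

end ConeAbstract

section ConeWilson

variable {L : ℕ} [NeZero L]

/-- **B1 (CONE NON-VANISHING, Wilson).** If the Hermitian Wilson–Dirac operator at the DEGENERATE
bare mass `m̄` has no eigenvalue in the window `(−w, w)` — EXTINCT(b)'s currency, verbatim — then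
`det D_W(U, μ, 1) ≠ 0` for every bare mass `μ` with `|μ − m̄| < w`: window-cleanliness at ONE bare
mass controls a whole bare-mass interval of half-width `w` (Neumann: `‖(D_W + m̄)⁻¹‖ = ‖H_W(m̄)⁻¹‖ ≤ 1/w`,
`Γ₅` unitary).  [signature] -/
theorem cone_fermionDet_ne_zero (U : GaugeConfig 4 L SU3) (mbar w μ : ℝ) (hw : 0 < w)
    (hclean : (spinorLift gammaFive *
        wilsonDirac (fundamentalRep (Fin 3)) U mbar 1).charpoly.roots.countP
          (fun z : ℂ => |z.re| < w) = 0)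
    (hμ : |μ - mbar| < w) :
    fermionDet (wilsonDirac (fundamentalRep (Fin 3)) U μ 1) ≠ 0 := by
  sorry

/-- **B2 (CONE SIGN CONSTANCY).** Under the same hypothesis the (real) Wilson determinant keeps the
sign it has at `m̄` on the whole cone: `0 < Re det D_W(m̄) · Re det D_W(μ)` (intermediate value
theorem along the bare-mass segment, using B1 at every intermediate mass; realness by
γ₅-hermiticity).  [signature] -/
theorem cone_sign_constant (U : GaugeConfig 4 L SU3) (mbar w μ : ℝ) (hw : 0 < w)
    (hclean : (spinorLift gammaFive *
        wilsonDirac (fundamentalRep (Fin 3)) U mbar 1).charpoly.roots.countP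
          (fun z : ℂ => |z.re| < w) = 0)
    (hμ : |μ - mbar| < w) :
    0 < (fermionDet (wilsonDirac (fundamentalRep (Fin 3)) U mbar 1)).re *
      (fermionDet (wilsonDirac (fundamentalRep (Fin 3)) U μ 1)).re := by
  sorry

/-- **B3 (SPLIT-PAIR POSITIVITY — the N_f = 2 sign problem in the cone is EMPTY).** If `H_W(m̄)` is
window-clean with window `w`, then for ANY two bare masses `μ₁, μ₂` within `w` of `m̄` the honest
two-flavour weight `det D_W(μ₁) · det D_W(μ₂)` is a positive real number: split-mass sign defects
(`WilsonDeterminantMassSplitting`: "real modes between the two flavour masses") are a SUBSET of the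
window defects of the degenerate operator.  With `m̄(k) = m_crit(k) + a_k m̄/Z_k`, `w = c a_k m̄/Z_k`
this covers every renormalised tuple with `|m_f − m̄| < c·m̄`.  [signature; = B2 twice] -/
theorem splitPair_pos_of_degenerateClean (U : GaugeConfig 4 L SU3) (mbar w μ₁ μ₂ : ℝ) (hw : 0 < w)
    (hclean : (spinorLift gammaFive *
        wilsonDirac (fundamentalRep (Fin 3)) U mbar 1).charpoly.roots.countP
          (fun z : ℂ => |z.re| < w) = 0)
    (h₁ : |μ₁ - mbar| < w) (h₂ : |μ₂ - mbar| < w) :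
    0 < (fermionDet (wilsonDirac (fundamentalRep (Fin 3)) U μ₁ 1) *
      fermionDet (wilsonDirac (fundamentalRep (Fin 3)) U μ₂ 1)).re := by
  sorry

/-- **B4 (the cone is window-clean too, with a smaller window).** Neumann also transports the
COERCIVITY half: if `H_W(m̄)` has no eigenvalue in `(−w, w)` and `|μ − m̄| ≤ w/2`, then `H_W(μ)` has
no eigenvalue in `(−w/2, w/2)` (Weyl: `H_W(μ) − H_W(m̄) = (μ − m̄)Γ₅`, norm `|μ − m̄|`).  So EXTINCT(b)
at the degenerate tuple implies EXTINCT(b) (constant `c/2`) on the whole cone, configuration by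
configuration.  [signature; = landed `Negative.abs_negCount_sub_le_windowCount`-type Weyl] -/
theorem cone_windowClean (U : GaugeConfig 4 L SU3) (mbar w μ : ℝ) (hw : 0 < w)
    (hclean : (spinorLift gammaFive *
        wilsonDirac (fundamentalRep (Fin 3)) U mbar 1).charpoly.roots.countP
          (fun z : ℂ => |z.re| < w) = 0)
    (hμ : |μ - mbar| ≤ w / 2) :
    (spinorLift gammaFive *
        wilsonDirac (fundamentalRep (Fin 3)) U μ 1).charpoly.roots.countP
          (fun z : ℂ => |z.re| < w / 2) = 0 := by
  sorry

end ConeWilson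

/-! ## §A  Card A — fermionic level repulsion (the determinant is its own Wegner weight) -/

section ResonanceAlgebra

/-- **A1 (two-level sign matrix; r1-3's resonant wells made quantitative).** For the real symmetric
`M = [[a, t], [t, b]]` with `det M = ab − t² < 0` (the only case in which `sgn M ≠ ±1`), the
off-diagonal entry of `sgn M = (2M − (a+b))/(μ₊ − μ₋)` is `2t/√((a−b)² + 4t²)`, and it is bounded by
`2|t| / max(|a|,|b|)`: the sign matrix couples two levels appreciably ONLY when BOTH lie within
`O(|t|)` of zero.  (For `a = b = 0` one gets the triager's `sgn(ε σₓ) = σₓ`.) -/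
theorem sgn2_offdiag_le (a b t : ℝ) (hab : a * b < t ^ 2) (h0 : 0 < max |a| |b|) :
    |2 * t / Real.sqrt ((a - b) ^ 2 + 4 * t ^ 2)| ≤ 2 * |t| / max |a| |b| := by
  sorry

/-- **A2 (… and resonance is priced by the determinant).** On the resonant set `|a|, |b| ≤ 2|t|`
the determinant weight is `|det M| = |ab − t²| ≤ 5 t²`: under a `|det|`-weighted measure the resonant
two-well configurations carry weight `O(t²)`, `t ≍ e^{−κ·dist}` the tunnelling amplitude. -/
theorem det2_resonant_le (a b t : ℝ) (ha : |a| ≤ 2 * |t|) (hb : |b| ≤ 2 * |t|) :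
    |a * b - t ^ 2| ≤ 5 * t ^ 2 := by
  have h1 : |a * b| ≤ 4 * t ^ 2 := by
    rw [abs_mul]
    calc |a| * |b| ≤ (2 * |t|) * (2 * |t|) := by
          apply mul_le_mul ha hb (abs_nonneg _) (by positivity)
      _ = 4 * t ^ 2 := by rw [← sq_abs t]; ring
  calc |a * b - t ^ 2| ≤ |a * b| + |t ^ 2| := abs_sub _ _
    _ ≤ 4 * t ^ 2 + t ^ 2 := by
        gcongr
        rw [abs_of_nonneg (sq_nonneg t)]
    _ = 5 * t ^ 2 := by ring

end ResonanceAlgebra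

section SelfImprovement

/-- **A3 (self-improvement under a vanishing weight, abstract).** Let `λ` be a real random variable,
`ρ ≥ 0` a weight (the "bulk" factor) and `ν ≥ 1`.  If the `ρ`-tilted law of `λ` is REGULAR at scales
below `σ` (small-ball bound `m(τ) ≤ K (τ/σ) m(σ)`, `m(τ) := ∫_{|λ|<τ} ρ` — the LOCAL LEVEL REGULARITY
input), then the `|λ|^ν ρ`-tilted mass of `{|λ| < τ}` is `≤ K τ^ν (τ/σ) m(σ)`: an extra factor
`τ^ν` — the determinant's zero — on top of Wegner.  (Trivial: `|λ|^ν ≤ τ^ν` on the event.) -/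
theorem selfImproving_window {Ω : Type*} [MeasurableSpace Ω] (P : Measure Ω)
    (lam ρ : Ω → ℝ) (hlam : Measurable lam) (hρ : ∀ ω, 0 ≤ ρ ω) (hρi : Integrable ρ P)
    (ν : ℕ) (σ K : ℝ) (hσ : 0 < σ)
    (hreg : ∀ τ : ℝ, 0 < τ → τ ≤ σ →
      ∫ ω in {ω | |lam ω| < τ}, ρ ω ∂P ≤ K * (τ / σ) * ∫ ω in {ω | |lam ω| < σ}, ρ ω ∂P)
    (τ : ℝ) (hτ : 0 < τ) (hτσ : τ ≤ σ) :
    ∫ ω in {ω | |lam ω| < τ}, |lam ω| ^ ν * ρ ω ∂P ≤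
      K * τ ^ ν * (τ / σ) * ∫ ω in {ω | |lam ω| < σ}, ρ ω ∂P := by
  sorry

end SelfImprovement

section StubShapes

variable {Nf : ℕ}

/-- **A4 — DETERMINANTAL WINDOW LAW (the typed consequence Card A's line would register as a stub;
phase-quenched, per witness `reg`, window constant `c`, tuple `m`).**  The phase-quenched expected
number of eigenvalues of `H_W(m_f(k)) = Γ₅ D_W(U, m_f(k), 1)` in the SUB-window `(−θw, θw)`,
`w = c a_k m_f/Z_k`, is at most `K θ² ×` the expected number in the full window `(−w, w)`, for all
`θ ∈ (0,1]`, eventually in `k`, on every torus `S ≥ L_k`: EXTINCT(b) improves ITSELF quadratically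
below its own scale, because the weight `∏_f |det D_W(m_f(k))| = ∏ |λ_i|` vanishes (at least
linearly) exactly where a window eigenvalue does.  Exponent `2 = ν + 1` with `ν = 1` (split masses;
`ν = N_f` at degenerate tuples). -/
def DeterminantalWindowLaw (reg : QCDRegularisation Nf) (c : ℝ) (m : Fin Nf → ℝ) : Prop :=
  ∃ K : ℝ, ∀ f : Fin Nf, ∀ θ : ℝ, 0 < θ → θ ≤ 1 → ∀ᶠ k in atTop, ∀ S : ℕ, reg.L k ≤ S →
    qcdPhaseQuenchedExpect (reg.β k) (2 * S + 1) (fun fl => reg.mcrit k + reg.a k * m fl / reg.Zm k)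
        (fun U => (Multiset.countP (fun z : ℂ => |z.re| < θ * (c * (reg.a k * m f / reg.Zm k)))
          (spinorLift gammaFive * wilsonDirac (fundamentalRep (Fin 3)) U
            (reg.mcrit k + reg.a k * m f / reg.Zm k) 1).charpoly.roots : ℝ)) ≤
      K * θ ^ 2 *
        qcdPhaseQuenchedExpect (reg.β k) (2 * S + 1)
          (fun fl => reg.mcrit k + reg.a k * m fl / reg.Zm k)
          (fun U => (Multiset.countP (fun z : ℂ => |z.re| < c * (reg.a k * m f / reg.Zm k))
            (spinorLift gammaFive * wilsonDirac (fundamentalRep (Fin 3)) U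
              (reg.mcrit k + reg.a k * m f / reg.Zm k) 1).charpoly.roots : ℝ))

/-- **A5 — TWO-WELL NON-RESONANCE (second factorial moment).**  The phase-quenched expectation of
`N_θ (N_θ − 1)`, `N_θ` the number of eigenvalues of `H_W(m_f(k))` in `(−θw, θw)`, is at most
`K θ⁴ ×` that of `N_1 (N_1 − 1) + N_1` at the full window: PAIRS of near-zero levels cost `θ²` EACH.
With `θ w ≍` the tunnelling amplitude `e^{−κ_k d}` between two W3-wells at distance `d` (landed
`stub_windowModesLocalised`, rate `κ_k = θ' c a_k m/(768 Z_k)`), resonant pairs are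
`O(e^{−4κ_k d})`-rare in phase-quenched mean — the NON-RESONANCE input that the sign-matrix /
Fermi-projector screening between separated wells was missing (TRIAGE-r1-3 on `sparse-window-wells`). -/
def TwoWellNonResonance (reg : QCDRegularisation Nf) (c : ℝ) (m : Fin Nf → ℝ) : Prop :=
  ∃ K : ℝ, ∀ f : Fin Nf, ∀ θ : ℝ, 0 < θ → θ ≤ 1 → ∀ᶠ k in atTop, ∀ S : ℕ, reg.L k ≤ S →
    qcdPhaseQuenchedExpect (reg.β k) (2 * S + 1) (fun fl => reg.mcrit k + reg.a k * m fl / reg.Zm k)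
        (fun U =>
          let N : ℝ := (Multiset.countP (fun z : ℂ => |z.re| < θ * (c * (reg.a k * m f / reg.Zm k)))
            (spinorLift gammaFive * wilsonDirac (fundamentalRep (Fin 3)) U
              (reg.mcrit k + reg.a k * m f / reg.Zm k) 1).charpoly.roots : ℝ)
          N * (N - 1)) ≤
      K * θ ^ 4 *
        qcdPhaseQuenchedExpect (reg.β k) (2 * S + 1)
          (fun fl => reg.mcrit k + reg.a k * m fl / reg.Zm k)
          (fun U =>
            let N : ℝ := (Multiset.countP (fun z : ℂ => |z.re| < c * (reg.a k * m f / reg.Zm k))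
              (spinorLift gammaFive * wilsonDirac (fundamentalRep (Fin 3)) U
                (reg.mcrit k + reg.a k * m f / reg.Zm k) 1).charpoly.roots : ℝ)
            N * (N - 1) + N)

/-- **B5 — GROWTH (objection O1), the class clause both cards carry explicitly** (Disproof §8b/§10a;
`Negative/VolumeFloor` p149644, `Negative/VolumeGrowth` p154859): the scheme torus outgrows the
kinematic scale, `a_k L_k / Z_k → ∞`. -/
def Growth (reg : QCDRegularisation Nf) : Prop :=
  Tendsto (fun k => reg.a k * reg.L k / reg.Zm k) atTop atTop

end StubShapes

end Summit.QuantumFields.QCD.Cruxes.ExtinctionBuildsQCD.Ideator5
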